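import Literature.NumberTheory.Automorphic.AdelicSchwartzBruhatDirectSumPure
import HarnessLib

/-!
# Adelic Schwartz–Bruhat functions on `𝔸_K^{ι₁ ⊕ ι₂}` that are FINITE SUMS OF PURE TENSORS `Φ⋆ ⊠ Φ^⊥`

Topic `NumberTheory/Automorphic`; namespace `Literature.NumberTheory.Automorphic`.  THEOREMS ONLY (no definition, no
named fact).  Cell `hodgecm-mathlib`, (T2) [Liu2021, Thm 4.15] stub S2 «theta restricts to theta», piece **S2d**
(A-plan2 LIU415-SPEC §4; A-p09 READFIRST §7): Liu's sentence (FJcycle.tex l. 2199–2203) «we can find finitely many pairs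
`(φ_{⋆,i}, φ_{⋆,i}^⊥)` with `φ_{⋆,i} ∈ 𝒮(V⋆^e(𝔸_F))` and `φ_{⋆,i}^⊥ ∈ 𝒮(V⋆^{⊥e}(𝔸_F))` … such that
`φ(v⋆, v⋆^⊥) = Σ_i φ_{⋆,i}(v⋆) · φ_{⋆,i}^⊥(v⋆^⊥)`» — read on the tree's adelic Schwartz–Bruhat space
`𝒮(𝔸_K^ι) = 𝓢((K ⊗ ℝ)^ι) ⊗ 𝒮((𝔸_K^∞)^ι)` (`piSchwartzBruhat`, `piSchwartzBruhatEquiv`) along an index split `ι = ι₁ ⊕ ι₂`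
(coordinates adapted to an orthogonal decomposition `V = V⋆ ⊕ V⋆^⊥`), with `⊠ = tensorToSum K ι₁ ι₂`.

WHAT IS PROVED.  The finite (non-archimedean) factor is an honest algebraic tensor product
(`finSumEquiv : FinSB K ι₁ ⊗ FinSB K ι₂ ≃ FinSB K (ι₁ ⊕ ι₂)`), so the ONLY obstruction to being a finite sum of pure tensors
is archimedean (a general Schwartz function on `(K ⊗ ℝ)^{ι₁ ⊕ ι₂}` is not a finite sum of products — Liu works in the Fock
model, where his test vectors are):
* `piSchwartzBruhatEquiv_archBoxTensor_tmul_mem_span_tensorToSum` — if the archimedean component is a product in separate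
  variables `Φ₁^∞ ⊠_∞ Φ₂^∞` (`archBoxTensor`), then for EVERY finite component `f` the adelic function
  `(Φ₁^∞ ⊠_∞ Φ₂^∞) ⊗ f` is a finite sum of adelic pure tensors (lies in the `ℂ`-span of the range of `⊠`);
* `exists_sum_tensorToSum_eq_of_mem_span` — «finitely many pairs»: membership in that span, unfolded as a finite sum
  `∑ i, Φ⋆ i ⊠ Φ^⊥ i` (coefficients absorbed into the first factor);
* `tensorToSum_mem_span_archBoxTensor` and `span_range_tensorToSum_eq_span_archBoxTensor` — conversely every pure tensor,
  hence every finite sum of pure tensors, is generated by adelic functions with separate-variable archimedean component: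
  the two spans COINCIDE.
The archimedean factorisations of the SPECIFIC test vectors (Gaussian of a majorant adapted to the split, times a form
in the `V⋆`-variables) are instances of `archBoxTensor` supplied where those vectors live (cf. the tree's
`schwartzReindexCLM_archBoxTensor_gaussianV` for the Gaussian vacuum); this file is the split-independent bookkeeping.
[cite: Weil1964, Chap. I n° 29 (standard functions on adelic spaces are finite sums of products of local ones)]
[cite: Liu2021, proof of Thm. 4.15 (FJcycle.tex l. 2199–2203)]
-/

set_option autoImplicit false

noncomputable section

open NumberField NumberField.InfinitePlace NumberField.mixedEmbedding IsDedekindDomain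
open scoped SchwartzMap TensorProduct Classical

namespace Literature.NumberTheory.Automorphic

variable {K : Type} [Field K] [NumberField K] {ι₁ ι₂ : Type} [Fintype ι₁] [Fintype ι₂]

/-- A pure tensor `Φ⋆ ⊠ Φ^⊥` lies in the span of the pure tensors. [folklore] -/
private theorem tensorToSum_mem_span_range (a : piSchwartzBruhat K ι₁) (b : piSchwartzBruhat K ι₂) :
    tensorToSum K ι₁ ι₂ a b ∈ Submodule.span ℂ
      (Set.range fun p : ↥(piSchwartzBruhat K ι₁) × ↥(piSchwartzBruhat K ι₂) => tensorToSum K ι₁ ι₂ p.1 p.2) :=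
  Submodule.subset_span ⟨(a, b), rfl⟩

/-- **«finitely many pairs» (Liu, l. 2199–2203), adelic form.**  If the archimedean component of an adelic Schwartz–Bruhat
function on `𝔸_K^{ι₁ ⊕ ι₂}` is a product of Schwartz functions in the separate variable blocks `ι₁`, `ι₂`
(`archBoxTensor Φ₁ Φ₂`), then — whatever its finite component `f ∈ 𝒮((𝔸_K^∞)^{ι₁ ⊕ ι₂})` — the function is a FINITE SUM
OF PURE TENSORS `Φ⋆ ⊠ Φ^⊥`, `Φ⋆ ∈ 𝒮(𝔸_K^{ι₁})`, `Φ^⊥ ∈ 𝒮(𝔸_K^{ι₂})`: it lies in the `ℂ`-span of the range of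
`tensorToSum K ι₁ ι₂`.  Proof: `f = finSumEquiv t` for a tensor `t = Σ f₁ ⊗ f₂` of finite Schwartz–Bruhat functions, and
`(Φ₁ ⊠_∞ Φ₂) ⊗ finSumEquiv (f₁ ⊗ f₂) = (Φ₁ ⊗ f₁) ⊠ (Φ₂ ⊗ f₂)` (`tensorToSum_tmul`).
[cite: Liu2021, proof of Thm. 4.15 (FJcycle.tex l. 2199–2203)] [cite: Weil1964, Chap. I n° 29] -/
theorem piSchwartzBruhatEquiv_archBoxTensor_tmul_mem_span_tensorToSum (Φ₁ : 𝓢((ι₁ → mixedSpace K), ℂ))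
    (Φ₂ : 𝓢((ι₂ → mixedSpace K), ℂ)) (f : FinSB K (ι₁ ⊕ ι₂)) :
    piSchwartzBruhatEquiv K (ι₁ ⊕ ι₂) (archBoxTensor Φ₁ Φ₂ ⊗ₜ f) ∈ Submodule.span ℂ
      (Set.range fun p : ↥(piSchwartzBruhat K ι₁) × ↥(piSchwartzBruhat K ι₂) => tensorToSum K ι₁ ι₂ p.1 p.2) := by
  obtain ⟨t, rfl⟩ : ∃ t, finSumEquiv K ι₁ ι₂ t = f := ⟨(finSumEquiv K ι₁ ι₂).symm f, LinearEquiv.apply_symm_apply _ _⟩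
  induction t using TensorProduct.induction_on with
  | zero =>
    rw [map_zero, TensorProduct.tmul_zero, map_zero]
    exact Submodule.zero_mem _
  | tmul f₁ f₂ =>
    rw [← tensorToSum_tmul]
    exact tensorToSum_mem_span_range _ _
  | add t₁ t₂ h₁ h₂ =>
    rw [map_add, TensorProduct.tmul_add, map_add]
    exact Submodule.add_mem _ h₁ h₂

/-- **Unfolding «lies in the span of the pure tensors» as «is a finite sum `∑ i, Φ⋆ i ⊠ Φ^⊥ i`»** (the coefficients of a
linear combination are absorbed into the first factor, `⊠` being bilinear). [folklore]
[cite: Liu2021, proof of Thm. 4.15 (FJcycle.tex l. 2199–2203)] -/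
theorem exists_sum_tensorToSum_eq_of_mem_span {Φ : ↥(piSchwartzBruhat K (ι₁ ⊕ ι₂))}
    (hΦ : Φ ∈ Submodule.span ℂ
      (Set.range fun p : ↥(piSchwartzBruhat K ι₁) × ↥(piSchwartzBruhat K ι₂) => tensorToSum K ι₁ ι₂ p.1 p.2)) :
    ∃ (n : ℕ) (a : Fin n → ↥(piSchwartzBruhat K ι₁)) (b : Fin n → ↥(piSchwartzBruhat K ι₂)),
      Φ = ∑ i, tensorToSum K ι₁ ι₂ (a i) (b i) := by
  obtain ⟨c, hc⟩ := (Finsupp.mem_span_range_iff_exists_finsupp).1 hΦ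
  refine ⟨c.support.card, fun i => c (c.support.equivFin.symm i).1 • (c.support.equivFin.symm i).1.1,
    fun i => (c.support.equivFin.symm i).1.2, ?_⟩
  rw [← hc, Finsupp.sum, ← Finset.sum_coe_sort]
  refine Fintype.sum_equiv c.support.equivFin _ _ fun p => ?_
  simp only [Equiv.symm_apply_apply, LinearMap.map_smul₂]

/-- **«finitely many pairs», finite-sum form.** [cite: Liu2021, proof of Thm. 4.15 (FJcycle.tex l. 2199–2203)]
[cite: Weil1964, Chap. I n° 29] -/
theorem exists_sum_tensorToSum_eq_piSchwartzBruhatEquiv_archBoxTensor_tmul (Φ₁ : 𝓢((ι₁ → mixedSpace K), ℂ))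
    (Φ₂ : 𝓢((ι₂ → mixedSpace K), ℂ)) (f : FinSB K (ι₁ ⊕ ι₂)) :
    ∃ (n : ℕ) (a : Fin n → ↥(piSchwartzBruhat K ι₁)) (b : Fin n → ↥(piSchwartzBruhat K ι₂)),
      piSchwartzBruhatEquiv K (ι₁ ⊕ ι₂) (archBoxTensor Φ₁ Φ₂ ⊗ₜ f) = ∑ i, tensorToSum K ι₁ ι₂ (a i) (b i) :=
  exists_sum_tensorToSum_eq_of_mem_span (piSchwartzBruhatEquiv_archBoxTensor_tmul_mem_span_tensorToSum Φ₁ Φ₂ f)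

/-- **Conversely, every pure tensor `Φ⋆ ⊠ Φ^⊥` is generated by adelic functions whose archimedean component is a product
in separate variables** (write `Φ⋆`, `Φ^⊥` as sums of `Φ^∞ ⊗ f` — `piSchwartzBruhatEquiv` is onto — and use bilinearity of
`⊠` with `tensorToSum_tmul`). [cite: Weil1964, Chap. I n° 29] -/
theorem tensorToSum_mem_span_archBoxTensor (a : ↥(piSchwartzBruhat K ι₁)) (b : ↥(piSchwartzBruhat K ι₂)) :
    tensorToSum K ι₁ ι₂ a b ∈ Submodule.span ℂ
      {Φ | ∃ (Φ₁ : 𝓢((ι₁ → mixedSpace K), ℂ)) (Φ₂ : 𝓢((ι₂ → mixedSpace K), ℂ)) (f : FinSB K (ι₁ ⊕ ι₂)),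
        Φ = piSchwartzBruhatEquiv K (ι₁ ⊕ ι₂) (archBoxTensor Φ₁ Φ₂ ⊗ₜ f)} := by
  obtain ⟨ta, rfl⟩ : ∃ t, piSchwartzBruhatEquiv K ι₁ t = a := ⟨(piSchwartzBruhatEquiv K ι₁).symm a, LinearEquiv.apply_symm_apply _ _⟩
  obtain ⟨tb, rfl⟩ : ∃ t, piSchwartzBruhatEquiv K ι₂ t = b := ⟨(piSchwartzBruhatEquiv K ι₂).symm b, LinearEquiv.apply_symm_apply _ _⟩
  induction ta using TensorProduct.induction_on with
  | zero =>
    rw [map_zero, LinearMap.map_zero₂]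
    exact Submodule.zero_mem _
  | add t₁ t₂ h₁ h₂ =>
    rw [map_add, LinearMap.map_add₂]
    exact Submodule.add_mem _ h₁ h₂
  | tmul Φa fa =>
    induction tb using TensorProduct.induction_on with
    | zero =>
      rw [map_zero, map_zero]
      exact Submodule.zero_mem _
    | add t₁ t₂ h₁ h₂ =>
      rw [map_add, map_add]
      exact Submodule.add_mem _ h₁ h₂
    | tmul Φb fb =>
      rw [tensorToSum_tmul]
      exact Submodule.subset_span ⟨Φa, Φb, finSumEquiv K ι₁ ι₂ (fa ⊗ₜ fb), rfl⟩

/-- **The two spans coincide**: the adelic Schwartz–Bruhat functions on `𝔸_K^{ι₁ ⊕ ι₂}` that are finite sums of pure tensors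
`Φ⋆ ⊠ Φ^⊥` are EXACTLY the `ℂ`-span of the functions with separate-variable archimedean component `(Φ₁^∞ ⊠_∞ Φ₂^∞) ⊗ f`.
[cite: Weil1964, Chap. I n° 29] [cite: Liu2021, proof of Thm. 4.15 (FJcycle.tex l. 2199–2203)] -/
theorem span_range_tensorToSum_eq_span_archBoxTensor :
    Submodule.span ℂ
        (Set.range fun p : ↥(piSchwartzBruhat K ι₁) × ↥(piSchwartzBruhat K ι₂) => tensorToSum K ι₁ ι₂ p.1 p.2) =
      Submodule.span ℂ
        {Φ | ∃ (Φ₁ : 𝓢((ι₁ → mixedSpace K), ℂ)) (Φ₂ : 𝓢((ι₂ → mixedSpace K), ℂ)) (f : FinSB K (ι₁ ⊕ ι₂)),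
          Φ = piSchwartzBruhatEquiv K (ι₁ ⊕ ι₂) (archBoxTensor Φ₁ Φ₂ ⊗ₜ f)} := by
  apply le_antisymm
  · refine Submodule.span_le.2 ?_
    rintro _ ⟨p, rfl⟩
    exact tensorToSum_mem_span_archBoxTensor p.1 p.2
  · refine Submodule.span_le.2 ?_
    rintro _ ⟨Φ₁, Φ₂, f, rfl⟩
    exact piSchwartzBruhatEquiv_archBoxTensor_tmul_mem_span_tensorToSum Φ₁ Φ₂ f

end Literature.NumberTheory.Automorphic

end
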